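import Summits.KontsevichZagierPeriods.KontsevichZagierPeriods.Theses.Grothendieck

/-!
# Crux GpcLegendreLemniscatic (stmt-KontsevichZagierPeriods-0280) — ideator 2, round 1: first lemmas

Two idea cards, two first checkable statements each (Props only; nothing is proved here):

* `nodal-fibre-band`: `NodalBandIntegrable`, `NodalBandMove`, `CertificateKillsBand`, `NodalFibreElementary`,
  `SwapSymmetrisation` and the composition shape `nodalBand_line_shape` (a `Prop`, not a proof).
* `isogeny-graph-gysin-certificate`: `IsogenyCertificate` (existence of an algebraic Stokes
  certificate regular on the closed real square, with the four edge representations summing to the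
  `π/2`-representation), and `SquareStokes` (two Newton–Leibniz moves on the square).
-/

noncomputable section

open Set MeasureTheory

namespace Summit.KontsevichZagierPeriods.KontsevichZagierPeriods.Cruxes.GpcLegendreLemniscatic

open Literature.NumberTheory.Transcendental

/-! ### Common data -/

/-- `wₛ(t) = √((1 − t²)(1 − s t²))` (the Jacobi quartic of modulus `k² = s`). -/
def jw (s t : ℝ) : ℝ := Real.sqrt ((1 - t ^ 2) * (1 - s * t ^ 2))

/-- The ONE-REPRESENTATION Legendre family `F_m(x,y) = (1 − m x² − (1−m) y²)/(w_m(x) w_{1−m}(y))`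
(= `κₘ(x)e_{1−m}(y) + (eₘ(x) − κₘ(x))κ_{1−m}(y)`, value `KE′ + EK′ − KK′ = π/2` for every `m ∈ (0,1)`;
`F_0(x,y) = 1/√(1−x²)` pointwise on the open square). -/
def legendreF (m x y : ℝ) : ℝ :=
  (1 - m * x ^ 2 - (1 - m) * y ^ 2) / (jw m x * jw (1 - m) y)

/-- `∂F/∂m`, written out as an algebraic function (`∂ₘw_m(x) = −x²(1−x²)/(2w)`,
`∂ₘw_{1−m}(y) = +y²(1−y²)/(2w′)`). -/
def legendreF' (m x y : ℝ) : ℝ :=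
  ((y ^ 2 - x ^ 2) * (jw m x * jw (1 - m) y)
      - (1 - m * x ^ 2 - (1 - m) * y ^ 2) *
        ((-(x ^ 2 * (1 - x ^ 2)) / (2 * jw m x)) * jw (1 - m) y
          + jw m x * (y ^ 2 * (1 - y ^ 2) / (2 * jw (1 - m) y)))) /
    (jw m x * jw (1 - m) y) ^ 2

/-- Gauss–Manin certificate, first component `G₁ = ½ x(1−x²) y² κₘ(x) κ_{1−m}(y)` (zero at `x ∈ {0,1}`). -/
def certG₁ (m x y : ℝ) : ℝ := x * (1 - x ^ 2) * y ^ 2 / (2 * (jw m x * jw (1 - m) y))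

/-- Gauss–Manin certificate, second component `G₂ = ½ x² y(1−y²) κₘ(x) κ_{1−m}(y)` (zero at `y ∈ {0,1}`);
`∂ₘF = ∂ₓG₁ − ∂_yG₂` (route GaussManinCertificates; re-verified to 1e−11). -/
def certG₂ (m x y : ℝ) : ℝ := x ^ 2 * y * (1 - y ^ 2) / (2 * (jw m x * jw (1 - m) y))

/-- The open unit square `(0,1)²`. -/
def sq : Set (Fin 2 → ℝ) := {p | ∀ i, p i ∈ Ioo (0:ℝ) 1}

/-- The CLOSED nodal band `(0,1)² × [0, ½]` in the shape of `KZ.newtonLeibnizRel`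
(parameter `m = z (Fin.last 2)` LAST, base `Fin.init z ∈ sq`, `a ≡ 0 ≤ m ≤ b ≡ ½`). -/
def nodalBand : Set (Fin 3 → ℝ) :=
  {z | (Fin.init z : Fin 2 → ℝ) ∈ sq ∧ (0:ℝ) ≤ z (Fin.last 2) ∧ z (Fin.last 2) ≤ 1 / 2}

/-! ### Idea `nodal-fibre-band` -/

/-- (I) THE LOAD-BEARING ESTIMATE: `∂ₘF ∈ L¹` of the closed band down to the nodal fibre `m = 0`
(numerics: `‖∂ₘF(·,·,m)‖_{L¹(sq)} ≈ ¼ log(1/m) + 0.35`, integrable in `m`). -/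
def NodalBandIntegrable : Prop :=
  IntegrableOn (fun z : Fin 3 → ℝ => legendreF' (z (Fin.last 2)) (z 0) (z 1)) nodalBand

/-- (NL in the modulus) ONE Newton–Leibniz move with the integrand family as its own primitive and the
DEGENERATE fibre `m = 0` as the lower end of the band: `[band, ∂ₘF] − [sq, F_{1/2} − F_0] ∈ relations`. -/
def NodalBandMove : Prop :=
  ∀ (R : KZ.IntegralRep 3) (r₀ : KZ.IntegralRep 2),
    R.domain = nodalBand →
    EqOn R.integrand (fun z => legendreF' (z (Fin.last 2)) (z 0) (z 1)) R.domain →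
    r₀.domain = sq →
    EqOn r₀.integrand (fun p => legendreF (1 / 2) (p 0) (p 1) - legendreF 0 (p 0) (p 1)) r₀.domain →
    KZ.of R - KZ.of r₀ ∈ KZ.relations

/-- (certificate) the band representation is a relation: `∂ₘF = ∂ₓG₁ − ∂_yG₂` on the open box, two
coordinate permutations and two Newton–Leibniz moves with primitives `G₁` (in `x`) and `−G₂` (in `y`),
boundary values `0`, null faces. -/
def CertificateKillsBand : Prop :=
  ∀ (R : KZ.IntegralRep 3), R.domain = nodalBand →
    EqOn R.integrand (fun z => legendreF' (z (Fin.last 2)) (z 0) (z 1)) R.domain →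
    KZ.of R ∈ KZ.relations

/-- (nodal fibre) `[sq, F_0] = [sq, (1 − x²)^{-1/2}] ≡ [ℝ, 1/(2(1+x²))]` by 1-dimensional moves
(NL in `y`, `x = 2t/(1+t²)`, dissection of `ℝ`, `x ↦ −x`, `x ↦ 1/x`). -/
def NodalFibreElementary : Prop :=
  ∀ (r₀ : KZ.IntegralRep 2) (r' : KZ.IntegralRep 1),
    r₀.domain = sq → EqOn r₀.integrand (fun p => legendreF 0 (p 0) (p 1)) r₀.domain →
    r'.domain = univ → EqOn r'.integrand (fun x => 1 / (2 * (1 + x 0 ^ 2))) r'.domain →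
    KZ.Equivalent r₀ r'

/-- (swap) the crux representation is the swap-symmetrisation of `F_{1/2}`:
`2e⊗k − k⊗k = g⊗k`, `F_{1/2} = k⊗e + e⊗k − k⊗k ≡ 2e⊗k − k⊗k` by one coordinate swap. -/
def SwapSymmetrisation : Prop :=
  ∀ (r rF : KZ.IntegralRep 2), r.domain = sq →
    EqOn r.integrand (fun x => 2 * Real.sqrt (1 - x 0 ^ 2 / 2) / Real.sqrt (1 - x 0 ^ 2) /
        Real.sqrt ((1 - x 1 ^ 2) * (1 - x 1 ^ 2 / 2)) -
      1 / Real.sqrt ((1 - x 0 ^ 2) * (1 - x 0 ^ 2 / 2)) / Real.sqrt ((1 - x 1 ^ 2) * (1 - x 1 ^ 2 / 2))) r.domain →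
    rF.domain = sq → EqOn rF.integrand (fun p => legendreF (1 / 2) (p 0) (p 1)) rF.domain →
    KZ.Equivalent r rF

/-- Shape of the line (for crux-plan, not a proof): the five statements above give the crux by
`Equivalent.trans` and integrand additivity (`[sq, F_{1/2} − F_0] ≡ [sq,F_{1/2}] − [sq,F_0]`). -/
def nodalBand_line_shape : Prop :=
  NodalBandIntegrable → NodalBandMove → CertificateKillsBand → NodalFibreElementary → SwapSymmetrisation →
    Summit.KontsevichZagierPeriods.KontsevichZagierPeriods.Theses.Grothendieck.GpcLegendreLemniscatic

/-! ### Idea `isogeny-graph-gysin-certificate` -/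

/-- The crux integrand at `m = ½` in symmetrised form `F_{1/2}(x,y) = (1 − (x²+y²)/2)/(w(x) w(y))`. -/
def Fhalf (p : Fin 2 → ℝ) : ℝ := legendreF (1 / 2) (p 0) (p 1)

/-- EXISTENCE OF THE GYSIN CERTIFICATE (Transfer C⁺): real ℚ-semialgebraic `M N` on the open square with
`F_{1/2} = ∂ₓN − ∂_yM` there, `N(·,y)` continuous on `[0,1]` and `M(x,·)` continuous on `[0,1]`
(the algebraic 1-form `A = M dx + N dy` is regular on the CLOSED real square because its polar divisor —
the graph of the translated 4-isogeny `q ↦ [2i]q + (0,−1)` and its conjugate — misses it), all band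
integrands absolutely integrable, and the four EDGE representations (1-periods of `C`, `C′` over `(0,1)`)
sum to the `π/2`-representation inside the rules. -/
def IsogenyCertificate : Prop :=
  ∃ (M N Nx My : (Fin 2 → ℝ) → ℝ),
    IsSemialgebraicFunOn ℚ sq M ∧ IsSemialgebraicFunOn ℚ sq N ∧
    IsSemialgebraicFunOn ℚ sq Nx ∧ IsSemialgebraicFunOn ℚ sq My ∧
    (∀ p ∈ sq, HasDerivAt (fun s : ℝ => N (Function.update p 0 s)) (Nx p) (p 0)) ∧
    (∀ p ∈ sq, HasDerivAt (fun s : ℝ => M (Function.update p 1 s)) (My p) (p 1)) ∧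
    (∀ p ∈ sq, Fhalf p = Nx p - My p) ∧
    IntegrableOn Nx sq ∧ IntegrableOn My sq ∧
    (∀ y ∈ Ioo (0:ℝ) 1, ContinuousOn (fun s : ℝ => N ![s, y]) (Icc 0 1)) ∧
    (∀ x ∈ Ioo (0:ℝ) 1, ContinuousOn (fun s : ℝ => M ![x, s]) (Icc 0 1)) ∧
    IntegrableOn (fun t : Fin 1 → ℝ => N ![1, t 0] - N ![0, t 0]) {t | t 0 ∈ Ioo (0:ℝ) 1} ∧
    IntegrableOn (fun t : Fin 1 → ℝ => M ![t 0, 1] - M ![t 0, 0]) {t | t 0 ∈ Ioo (0:ℝ) 1} ∧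
    (∀ (eN eM r' : KZ.IntegralRep 1),
      eN.domain = {t | t 0 ∈ Ioo (0:ℝ) 1} → EqOn eN.integrand (fun t => N ![1, t 0] - N ![0, t 0]) eN.domain →
      eM.domain = {t | t 0 ∈ Ioo (0:ℝ) 1} → EqOn eM.integrand (fun t => M ![t 0, 1] - M ![t 0, 0]) eM.domain →
      r'.domain = univ → EqOn r'.integrand (fun x => 1 / (2 * (1 + x 0 ^ 2))) r'.domain →
      KZ.of eN - KZ.of eM - KZ.of r' ∈ KZ.relations)

/-- TWO NEWTON–LEIBNIZ MOVES ON THE SQUARE with non-zero face terms (band in `y` over `(0,1)`; band in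
`x` after the coordinate swap; the closed/open square differ by null faces):
`[sq, ∂ₓN − ∂_yM] ≡ [(0,1), N(1,·) − N(0,·)] − [(0,1), M(·,1) − M(·,0)]`. -/
def SquareStokes : Prop :=
  ∀ (M N Nx My : (Fin 2 → ℝ) → ℝ) (r : KZ.IntegralRep 2) (eN eM : KZ.IntegralRep 1),
    IsSemialgebraicFunOn ℚ sq M → IsSemialgebraicFunOn ℚ sq N →
    (∀ p ∈ sq, HasDerivAt (fun s : ℝ => N (Function.update p 0 s)) (Nx p) (p 0)) →
    (∀ p ∈ sq, HasDerivAt (fun s : ℝ => M (Function.update p 1 s)) (My p) (p 1)) →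
    IntegrableOn Nx sq → IntegrableOn My sq →
    (∀ y ∈ Ioo (0:ℝ) 1, ContinuousOn (fun s : ℝ => N ![s, y]) (Icc 0 1)) →
    (∀ x ∈ Ioo (0:ℝ) 1, ContinuousOn (fun s : ℝ => M ![x, s]) (Icc 0 1)) →
    r.domain = sq → EqOn r.integrand (fun p => Nx p - My p) r.domain →
    eN.domain = {t | t 0 ∈ Ioo (0:ℝ) 1} → EqOn eN.integrand (fun t => N ![1, t 0] - N ![0, t 0]) eN.domain →
    eM.domain = {t | t 0 ∈ Ioo (0:ℝ) 1} → EqOn eM.integrand (fun t => M ![t 0, 1] - M ![t 0, 0]) eM.domain →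
    KZ.of r - (KZ.of eN - KZ.of eM) ∈ KZ.relations

/-- Shape of the second line: certificate + square Stokes + swap give the crux. -/
def isogenyCertificate_line_shape : Prop :=
  IsogenyCertificate → SquareStokes → SwapSymmetrisation →
    Summit.KontsevichZagierPeriods.KontsevichZagierPeriods.Theses.Grothendieck.GpcLegendreLemniscatic

end Summit.KontsevichZagierPeriods.KontsevichZagierPeriods.Cruxes.GpcLegendreLemniscatic
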